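import Summits.Ventures.HSemireg.MethodInstanceG6ThetaSecant
import Summits.Ventures.HSemireg.AmplificationChainG2n
import Summits.Ventures.HSemireg.FormulaNUniform
import HarnessLib

/-!
# Venture HSemireg — the g = 6 METHOD INSTANCE with the OBJECT side of its certificate read one level finer: FACTOR WINDOWS
# `(e₀, e₁, e₂) ≤ (1, 2n, n(n−1))` + Künneth ⟹ `dim Ext²(G,G) ≤ R₂(n)` («≤ 1·6 + 6·6 + 6·1 = 48» at `n = 3`), EXTREMAL factors ⟹ equality

HONEST FRAMING. Lean index of the computation cell `pub-hsemireg` (seat p8, «Sunday typer § g = 6»; successor file of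
`MethodInstanceG6ThetaSecant.lean` / `…Cells.lean`). Nothing about any explicit variety, sheaf or `Ext` group is asserted in the tree:
every theorem below is an implication whose published inputs are hypotheses BY NAME and whose objects and numbers are hypotheses BY
VALUE. Nothing here says HC, HC_CM or HC_AV is proved. The SIGNED verdict `target-g6/VERDICT-G6.md` v1.0 (`1651dcc7322662a2`) reads at
g = 6 «NO-in-families-tried» (deciding, non-split components), «candidates 0», and «YES as METHOD INSTANCES» on the split components
(V-1, V-3, V-4); this file, like its two predecessors, is about those METHOD INSTANCES only.

WHAT IS NEW HERE (the item both Sunday-typer honest lists left open and that sits on the g = 6 certificate — seat p10's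
`FormulaNUniformLaw.lean`: «NOT typed: the Ext-side law `dim Ext²(E,E) = R₂(n) + δ_E` with `δ_E = 0` exactly for EXTREMAL factors
(th-7 Σ3) — it enters as the hypothesis `hExt`»; seat p11's level-`N` ladder takes «`dim Ext²(G,G) ≤ boxRank N 2`» BY VALUE for the BOX).
The census reads the object side of the g = 6 certificate «rank 48 = bound 48» as a KÜNNETH SUM OF FACTOR CELLS: «the local-to-global E₂
UPPER bound `dim Ext²(E,E) ≤ 1·6 + 6·6 + 6·1 = 48` ⇒ ob surjective, σ INJECTIVE; Ext• profile forced (1,6,6,1)-type» (rows D-2…D-6, THETA-SECANT: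
factor `𝓕_m = i_*𝒪_D(m·C_p)`, `dim Ext^k(𝓕_m,𝓕_m) ≤ Σ_{p+q=k} h^p(D, Λ^q N_D) = (1, 3+3, 3+3)`, `step0/THETA-SECANT-p1.md` §2 (S3)) and «dim
`6 + 36 + 6 = 48`» (row C13-8, TRIANGLE SHEAF: factor `F_△ = I_{Z_△} ⊗ L` on `E³` with `e = (1, 6, 6, 1)`, EK-dg machine ×2 `kit j162321` /
`j162232` + paper ×3). This file makes that arithmetic KERNEL OUTPUT on the REAL carriers (`extRank`, a `Cardinal` rank of
`Hom_{D(Mod 𝒪)}(G, G⟦k⟧)`), uniformly in `n`: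

* §1 (`extRank_le_boxRank_of_kunneth_of_window`) if two objects `F₁ / F₂` (on any `ℂ`-schemes `Y₁ / Y₂`) have `Ext`-profiles IN THE WINDOW
  `e_i(F_j) ≤ r_i(n) := transversePairRank n i` for `i ≤ k` — `(r₀, r₁, r₂)(n) = (1, 2n, n(n−1))` for `n ≥ 3` is seat p10's `markmanWindow`
  ([Markman2025SecantWeil] Lemma 8.3.4 as read by the cell; `(1, 4, 1)` at `n = 2`) — and a third object `G` (on `Y₀`; for the cell
  `G = F₁ ⊠ F₂` on `Y₁ × Y₂`) satisfies the KÜNNETH identity in degree `k` BY VALUE, as an identity of numbers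
  `extRank Y₀ G k = Σ_{i+j=k} extRank Y₁ F₁ i · extRank Y₂ F₂ j` (printed: [Markman2025SecantWeil] §8.4, «the Künneth decomposition of
  `Ext²(π₁*F₁ ⊗ π₂*F₂, …)`»; the tree has no `⊠` on these carriers, so the identity — not the isomorphism — is what is taken), then
  `extRank Y₀ G k ≤ boxRank n k = R_k(n) = [t^k] P_n(t)²` — seat p10's box rank, DEFINED as that Cauchy product —, i.e. the OBJECT side of
  the rank door's clause `rank Ext²(E,E) ≤ r(P, ch E)` once the class side reads `r = R₂(n)` (kernel: seats p6/p8 theta boxes, p4/p10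
  point-pair boxes); and (`extRank_eq_boxRank_of_kunneth_of_extremal`) EXTREMAL factors `e_i = r_i(n)` (th-7 Def. B.4) give EQUALITY —
  STRUCTURE (S2)'s «`δ_G = 0` for extremal factors» in the only form the tree carries.
* §2 the numerals of record: `n = 3`: `(1, 6, 6) ⊠ (1, 6, 6) ↦ 6 + 36 + 6 = 48 = boxRank 3 2` (g = 6: D-2…D-6, C13-8); `n = 2`:
  `(1, 4, 1) ⊠ (1, 4, 1) ↦ 1 + 16 + 1 = 18 = boxRank 2 2` (the g = 4 ANCHOR's `dim Ext²(E₀, E₀) = 18`, `E₀ = Φ(I_p ⊠ I_q)`, STEP-0).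
* §3 the g = 6 METHOD INSTANCE RE-READ: seat p8's `…_of_certificate` (class side `r = 48` BY VALUE — theta-secant ×4 codes, triangle ×2)
  and `…_of_thetaSecant` (class side `r = 48` DERIVED in the kernel from the twisted-theta-box SHAPE) with the object-side binder
  `h2 : dim Ext²(G,G) ≤ 48` REPLACED by the two factor windows `≤ (1, 6, 6)` and the Künneth identity in degree `2`
  ⟹ `Stubs.WeilAlgebraicSplitHyperplane 3 d ∧ WeilAlgebraicAll 2 d` (split `ℚ(√-d)` sixfolds AND all `ℚ(√-d)` fourfolds; in print
  [Markman2025SecantWeil] Thm. 1.5.1 / Cor. 1.6.1 — PREPRINT —, refereed for `d = 3` [Schoen1988HodgeWeil]).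
* §4 LEVEL `N` (import, not restate: seat p11's `ladder_of_reach_of_perfectComplexRankTransfer_of_complex`): two factors in the window at
  level `N` + Künneth + class side `r = boxRank N 2` BY VALUE ⟹ `Stubs.WeilAlgebraicSplitHyperplane N d ∧ ∀ n, 2 ≤ n < N → WeilAlgebraicAll n d`.
* §5 the THETA-SECANT SHAPE at EVERY level `n ≥ 3`: class side `6n² − 2n` kernel-derived (seat p8 §1) `= boxRank n 2` (seat p10), object
  side from two factors in the window — no numeral hypothesis left; existence of such objects at a level is STRUCTURE (S4), not asserted.

BY NAME throughout: `weilFamilyReach_hyperbolic` (Deligne, refereed tree fact), `PerfectComplexRankTransfer C` (seat p4's door: the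
venture's ASSUMPTION, of printed strength on paper via [BuchweitzFlenner2008HH] Prop. 6.4.4 + [Perry2022] Prop. 8.1 / [Pridham2024Semiregularity]
/ [Lieblich2006]; the kernel links it to nothing, F-1). BY VALUE: anchors, classes, objects, the transport `hext`, `Ext^{<0}(G,G) = 0`,
`Hom(G,G) = ℂ`, the Künneth identity, and the FACTOR CELLS — NOT kernel facts (sheaf cohomology on `J(C)` / `E³`). What the kernel adds is
exactly the arithmetic «1·6 + 6·6 + 6·1 = 48» and its uniform-in-`n` form; `σ`-injectivity stays INFERRED ON PAPER from
«48 ≤ rank σ ≤ dim Ext² ≤ 48» ([BuchweitzFlenner2008HH] Prop. 6.4.4). The converse («the clause + the (S1) lower bounds force EXTREMAL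
factors», the cell's BOX-PRODUCT LEMMA) is the companion file `MethodInstanceG6ExtremalFactorsConverse.lean`. 0 `def`, 0 `sorry`, 0 new
named fact. Sources: [Markman2025SecantWeil] §8.4 (arXiv v2 p. 63, the sentence between (8.4.1) and (8.4.2)), Lemma 8.3.4, Thm. 1.5.1,
Cor. 1.6.1 (preprint); [BuchweitzFlenner2008HH] Prop. 6.4.4; [Schoen1988HodgeWeil]; [Schoen1998HodgeWeilAddendum] §10; [Deligne1982HodgeCycles]
proof of Thm. 4.8; cell files `target-g6/CENSUS.md` v3.75 rows D-2…D-6, C13-8; `step0/THETA-SECANT-p1.md` v2.6 §2; `general-structure/STRUCTURE.md`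
v1.0-SIGNED §2 (S1)/(S2)/(S4), §1 C6.
-/

noncomputable section

open CategoryTheory AlgebraicGeometry Set Finset
open CliffordAlgebra (contractLeft)
open ExteriorAlgebra (ι)
open Module
open Literature.AlgebraicGeometry.Motives Literature.AlgebraicGeometry.HodgeTheory
open Literature.AlgebraicGeometry.ModuliOfAbelianVarieties Literature.AlgebraicGeometry.Deligne1982
open Literature.AlgebraicGeometry.KTheory
open Literature.AlgebraicTopology.SingularHomology

namespace Summit.Ventures.HSemireg

open FormulaN (transversePairRank)
open FormulaN.Uniform (boxRank)

/-! ## §1 Factor windows ⟹ the box's rank-door clause; extremal factors ⟹ equality — real carriers, every `n`, every degree -/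

section Factors

variable {Y₀ Y₁ Y₂ : SchemeOver ℂ}

/-- **FACTORS IN MARKMAN'S WINDOW ⟹ `dim Ext^k(G,G) ≤ R_k(n)`** (the census's «local-to-global ∕ Künneth UPPER bound», uniform in `n` and
`k`). Three objects on three `ℂ`-schemes — `G` on `Y₀` (for the cell: the box `F₁ ⊠ F₂` on `Y₁ × Y₂`), `F₁` on `Y₁`, `F₂` on `Y₂` — with, BY
VALUE: `hK`, the KÜNNETH identity in degree `k` as an identity of ranks, `rank Ext^k(G,G) = Σ_{i+j=k} rank Extⁱ(F₁,F₁) · rank Extʲ(F₂,F₂)`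
(printed: «the Künneth decomposition of `Ext²(π₁*F₁ ⊗ π₂*F₂, π₁*F₁ ⊗ π₂*F₂)` is the direct sum `[Ext² ⊗ Ext⁰] ⊕ [Ext⁰ ⊗ Ext²] ⊕ [Ext¹ ⊗ Ext¹]`»,
stated there for the sheaves `F₁, F₂` of [Markman2025SecantWeil] Thm. 1.4.1 — a general fact for coherent sheaves on a product, used here
only as a by-value number identity); `hF₁`/`hF₂`, the factor WINDOWS `rank Extⁱ(F_j,F_j) ≤ r_i(n) = transversePairRank n i` for `i ≤ k`
(`(r₀, r₁, r₂)(n) = (1, 2n, n(n−1))` for `n ≥ 3` = seat p10's `markmanWindow`, [Markman2025SecantWeil] Lemma 8.3.4 as read by the cell; for the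
theta-secant factor the E₂ bound `dim Ext^k(i_*L, i_*L) ≤ Σ_{p+q=k} h^p(D, Λ^q N_D) = (1, 3+3, 3+3)`, THETA-SECANT-p1 §2 (S3)). Conclusion:
`rank Ext^k(G,G) ≤ boxRank n k = R_k(n) = [t^k] P_n(t)²` (seat p10's Cauchy product) — the OBJECT side of the rank door's clause.
[cite: Markman2025SecantWeil, §8.4, the Künneth decomposition between (8.4.1) and (8.4.2) (arXiv v2 p. 63), and Lemma 8.3.4 (preprint)] -/
theorem extRank_le_boxRank_of_kunneth_of_window (G : CochainComplex Y₀.left.Modules ℤ)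
    (F₁ : CochainComplex Y₁.left.Modules ℤ) (F₂ : CochainComplex Y₂.left.Modules ℤ) {n k : ℕ}
    (hK : extRank Y₀ G k = ∑ ij ∈ antidiagonal k, extRank Y₁ F₁ ij.1 * extRank Y₂ F₂ ij.2)
    (hF₁ : ∀ i : ℕ, i ≤ k → extRank Y₁ F₁ i ≤ transversePairRank n i)
    (hF₂ : ∀ j : ℕ, j ≤ k → extRank Y₂ F₂ j ≤ transversePairRank n j) :
    extRank Y₀ G k ≤ boxRank n k := by
  rw [hK, boxRank, Nat.cast_sum]
  refine Finset.sum_le_sum fun ij hij ↦ ?_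
  rw [Finset.HasAntidiagonal.mem_antidiagonal] at hij
  rw [Nat.cast_mul]
  exact mul_le_mul' (hF₁ ij.1 (by omega)) (hF₂ ij.2 (by omega))

/-- **EXTREMAL FACTORS ⟹ `dim Ext^k(G,G) = R_k(n)`** (STRUCTURE (S2) ∕ th-7 Σ3–Σ4, numerical core): as above with the windows replaced by
the EXTREMAL profiles `rank Extⁱ(F_j,F_j) = r_i(n)` (th-7 Def. B.4 «extremal: `e_i = r_i`»; the triangle sheaf's machine cell `e = (1, 6, 6, 1)`,
C13-8) — then the rank door's clause holds WITH EQUALITY, `δ_G = 0` in degree `k`.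
[cite: Markman2025SecantWeil, §8.4 (arXiv v2 p. 63; preprint)] -/
theorem extRank_eq_boxRank_of_kunneth_of_extremal (G : CochainComplex Y₀.left.Modules ℤ)
    (F₁ : CochainComplex Y₁.left.Modules ℤ) (F₂ : CochainComplex Y₂.left.Modules ℤ) {n k : ℕ}
    (hK : extRank Y₀ G k = ∑ ij ∈ antidiagonal k, extRank Y₁ F₁ ij.1 * extRank Y₂ F₂ ij.2)
    (hF₁ : ∀ i : ℕ, i ≤ k → extRank Y₁ F₁ i = transversePairRank n i)
    (hF₂ : ∀ j : ℕ, j ≤ k → extRank Y₂ F₂ j = transversePairRank n j) :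
    extRank Y₀ G k = boxRank n k := by
  rw [hK, boxRank, Nat.cast_sum]
  refine Finset.sum_congr rfl fun ij hij ↦ ?_
  rw [Finset.HasAntidiagonal.mem_antidiagonal] at hij
  rw [hF₁ ij.1 (by omega), hF₂ ij.2 (by omega), Nat.cast_mul]

end Factors

/-! ## §2 The numerals of record: `48` at `n = 3` (g = 6), `18` at `n = 2` (the g = 4 anchor) -/

/-- The window ∕ extremal profile at `n = 3` is `(r₀, r₁, r₂, r₃)(3) = (1, 6, 6, 1)` — the census cells «`dim Ext^•(𝓕_m,𝓕_m) ≤ (1, 3+3, 3+3, 1)`»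
(theta-secant factor, D-2…D-6; forced to equality by the class side) and «`e = (1, 6, 6, 1)`» (triangle sheaf `F_△`, C13-8) — and
**«1·6 + 6·6 + 6·1 = 48»**, the census's Künneth bound for `dim Ext²(G_m, G_m)` / «dim `6 + 36 + 6 = 48`» (C13-8), IS `R₂(3) = boxRank 3 2`,
the CLASS-side number `r(P, ch E) = 48` of the same rows («rank 48 = bound 48»). [bookkeeping] -/
theorem kunneth_three_two : (List.range 4).map (transversePairRank 3) = [1, 6, 6, 1] ∧
    transversePairRank 3 0 * transversePairRank 3 2 + transversePairRank 3 1 * transversePairRank 3 1 +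
        transversePairRank 3 2 * transversePairRank 3 0 = 48 ∧ boxRank 3 2 = 48 := by decide

/-- The g = 4 ANCHOR in the same currency: `(r₀, r₁, r₂)(2) = (1, 4, 1)` (the ideal sheaf of a point on an abelian SURFACE) and
«`1·1 + 4·4 + 1·1 = 18`» `= boxRank 2 2` — STEP-0's «rank ⌟ch(E₀) = 18 = dim Ext²(E₀,E₀)», `E₀ = Φ(I_p ⊠ I_q)` (VERDICT V-4, g = 4 YES as
method instances). [bookkeeping] -/
theorem kunneth_two_two : (List.range 3).map (transversePairRank 2) = [1, 4, 1] ∧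
      transversePairRank 2 0 * transversePairRank 2 2 + transversePairRank 2 1 * transversePairRank 2 1 +
        transversePairRank 2 2 * transversePairRank 2 0 = 18 ∧ boxRank 2 2 = 18 := by decide

/-! ## §3 The g = 6 METHOD INSTANCE re-read: object side = two factor windows `≤ (1, 6, 6)` + Künneth -/

section Instances

open Summit.HodgeConjecture.HodgeConjecture
open Summit.HodgeConjecture.HodgeConjecture.WeilTypeLadder
open Summit.HodgeConjecture.HodgeConjecture.Cruxes.HodgeAbelianVarieties.EStepSecantInduction
open Summit.Ventures.HSemireg.GeneralStructure

variable {C : ChernCharacterBetti}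
variable {Y₀ Y₁ Y₂ : SchemeOver ℂ}

/-- The object-side binder of seat p8's numeral certificate at `n = 3`, PRODUCED from the factor cells: `dim Ext²(G,G) ≤ 48` from the
windows `(rank Ext⁰, rank Ext¹, rank Ext²)(F_j) ≤ (1, 6, 6)` and Künneth in degree `2` («`≤ 1·6 + 6·6 + 6·1 = 48`»). [bookkeeping] -/
theorem extRank_box_three_le_of_factorWindow (G : CochainComplex Y₀.left.Modules ℤ)
    (F₁ : CochainComplex Y₁.left.Modules ℤ) (F₂ : CochainComplex Y₂.left.Modules ℤ)
    (hK : extRank Y₀ G (2 : ℕ) = ∑ ij ∈ antidiagonal (2 : ℕ), extRank Y₁ F₁ ij.1 * extRank Y₂ F₂ ij.2)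
    (hF₁ : ∀ i : ℕ, i ≤ 2 → extRank Y₁ F₁ i ≤ transversePairRank 3 i)
    (hF₂ : ∀ j : ℕ, j ≤ 2 → extRank Y₂ F₂ j ≤ transversePairRank 3 j) :
    extRank Y₀ G 2 ≤ 48 := by
  have h := extRank_le_boxRank_of_kunneth_of_window G F₁ F₂ (n := 3) (k := 2) hK hF₁ hF₂
  rw [kunneth_three_two.2.2] at h
  exact_mod_cast h

/-- **g = 6 METHOD INSTANCE, the certificate with the OBJECT SIDE READ FROM THE FACTOR CELLS** (class side BY VALUE: `hr : r(P, ch E) = 48`,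
the census's exact rank of `ξ ↦ ξ ⌟ ch(E)` on `HT²(P)` — theta-secant D-2…D-6 ×4 codes, triangle C13-8 ×2 codes). As seat p8's
`…_of_certificate` (BY NAME `weilFamilyReach_hyperbolic`, `PerfectComplexRankTransfer C`; BY VALUE the split CM sixfold anchor `(P, ψ₀)`,
`ψ₀² = -d`, hyperbolic, `w ≠ 0` rational in the Weil plane, `I ⊇ {1..6}`, ONE bounded complex of vector bundles `E` with `ch₃(E) = q·h_K³ + w`,
`ch_p(E) = c_p·h_Kᵖ` off `3`, its SOURCE `G` on `Y₀` with `hext` — the `Ext`-ranks of `E` and `G` agree in degrees `≤ 2`, Orlov ∘ `⊗ M` by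
value —, `Ext^{<0}(G,G) = 0`, `Hom(G,G) = ℂ`) EXCEPT that `dim Ext²(G,G) ≤ 48` is no longer a hypothesis: it is COMPUTED from the two FACTORS
`F₁` on `Y₁`, `F₂` on `Y₂` (theta-secant: `𝓕_m^∨`, `𝓕_m` on `X = J(C)`; triangle: `F_△^∨`, `F_△` on `E³`) with profiles IN THE WINDOW
`(rank Ext⁰, rank Ext¹, rank Ext²) ≤ (1, 6, 6)` (`hF₁`, `hF₂` — the census's factor cells, BY VALUE: the E₂ bound `(1, 3+3, 3+3)` resp. the
machine cell `(1, 6, 6)`) and the Künneth identity in degree `2` (`hK`, BY VALUE). Conclusion: `Stubs.WeilAlgebraicSplitHyperplane 3 d`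
(every abelian sixfold of the SPLIT `ℚ(√-d)`-Weil component)
`∧ WeilAlgebraicAll 2 d` (every `ℚ(√-d)`-Weil abelian fourfold, every discriminant). In print: [Markman2025SecantWeil] Thm. 1.5.1 / Cor. 1.6.1
(PREPRINT); refereed for `d = 3` ([Schoen1988HodgeWeil]). Re-derived modulo the named hypotheses; nothing about non-split sixfolds.
[cite: Markman2025SecantWeil, Thm. 1.5.1, Cor. 1.6.1, Lemma 8.3.4 and §8.4 (preprint)] [cite: BuchweitzFlenner2008HH, Prop. 6.4.4]
[cite: Schoen1988HodgeWeil, Cor. 3.1 and Thm. 3.2 (K = ℚ(√-3))] [cite: Deligne1982HodgeCycles, proof of Thm. 4.8] -/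
theorem weilSixfoldsSplit_and_fourfoldsAll_of_reach_of_perfectComplexRankTransfer_of_factorWindow
    (hF : weilFamilyReach_hyperbolic) (hT : PerfectComplexRankTransfer C) {d : ℕ} (hd : 0 < d)
    (P : AbelianVariety ℂ) (ψ₀ : P ⟶ P) (e : ProjectiveEmbedding P.X) (a : complexBetti (projectiveSpace e.n ℂ) 2)
    (hP : P.dim = 2 * 3) (hψ : ψ₀ ≫ ψ₀ = -(d • 𝟙 P)) (ha : IsRationalClass a) (ha0 : a ≠ 0)
    (hhyp : IsHyperbolicWeilType P ψ₀ 3 (symmetrisedClass d P ψ₀ e a))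
    (w : complexBetti P.X (2 * 3)) (hwW : w ∈ weilClassesOf P ψ₀ 3 d) (hwr : IsRationalClass w) (hw0 : w ≠ 0)
    (I : Finset ℕ) (hI : ∀ p : ℕ, 1 ≤ p → p ≤ 2 * 3 → p ∈ I) (E : CochainComplex P.X.left.Modules ℤ) (hE : IsBoundedVBComplex E)
    (q : ℚ) (c : ℕ → ℚ)
    (hch3 : chPerfect C P.X E hE.isFiniteLocallyFree 3 = ((q : ℚ) : ℂ) • cupPowTwo (symmetrisedClass d P ψ₀ e a) 3 + w)
    (hchp : ∀ p ∈ I, p ≠ 3 →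
      chPerfect C P.X E hE.isFiniteLocallyFree p = ((c p : ℚ) : ℂ) • cupPowTwo (symmetrisedClass d P ψ₀ e a) p)
    -- class side of the certificate, BY VALUE
    (hr : contractionRank P (fun p ↦ chPerfect C P.X E hE.isFiniteLocallyFree p) = ((48 : ℕ) : Cardinal))
    -- object side: the source box `G`, its transport to `E`, and its two FACTORS in the window (BY VALUE)
    (G : CochainComplex Y₀.left.Modules ℤ) (hext : ∀ m : ℤ, m ≤ 2 → extRank P.X E m = extRank Y₀ G m)
    (hneg : ∀ m : ℤ, m < 0 → extRank Y₀ G m = 0) (h0 : extRank Y₀ G 0 = 1)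
    (F₁ : CochainComplex Y₁.left.Modules ℤ) (F₂ : CochainComplex Y₂.left.Modules ℤ)
    (hK : extRank Y₀ G (2 : ℕ) = ∑ ij ∈ antidiagonal (2 : ℕ), extRank Y₁ F₁ ij.1 * extRank Y₂ F₂ ij.2)
    (hF₁ : ∀ i : ℕ, i ≤ 2 → extRank Y₁ F₁ i ≤ transversePairRank 3 i)
    (hF₂ : ∀ j : ℕ, j ≤ 2 → extRank Y₂ F₂ j ≤ transversePairRank 3 j) :
    Stubs.WeilAlgebraicSplitHyperplane 3 d ∧ WeilAlgebraicAll 2 d :=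
  weilSixfoldsSplit_and_fourfoldsAll_of_reach_of_perfectComplexRankTransfer_of_certificate hF hT hd P ψ₀ e a hP hψ ha ha0 hhyp w
    hwW hwr hw0 I hI E hE q c hch3 hchp 48 hr G hext hneg h0 (extRank_box_three_le_of_factorWindow G F₁ F₂ hK hF₁ hF₂)

variable {W₁ W₂ : Type} [AddCommGroup W₁] [Module ℂ W₁] [AddCommGroup W₂] [Module ℂ W₂] [FiniteDimensional ℂ W₂]
variable {m : ℕ} (β₂ : Module.Basis (Fin m) ℂ W₂) (M₁ : Submodule ℂ W₁) (M₂ : Submodule ℂ W₂)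
variable {Asrc : AbelianVariety ℂ} {V₁ V₂ L₁ L₂ : Submodule ℂ (complexBetti Asrc.X 1)}

/-- **g = 6 METHOD INSTANCE, BOTH SIDES OF «48 = 48» PRODUCED IN THE KERNEL from shape data**: the CLASS side `r(P, ch E) = 48` from the
twisted-theta-box SHAPE of `ch(μ_*(𝓕_m^∨ ⊠ 𝓕_m))` transported along the partial Fourier transform and twisted by `e^{c₁(M_m)}` (seat p8's
`contractionRank_eq_of_partialFourier_thetaBox` at `n = 3`; frame binders as in `…_of_thetaSecant`, BY VALUE), the OBJECT side
`dim Ext²(G_m,G_m) ≤ 6 + 36 + 6 = 48` from the two FACTOR WINDOWS `≤ (1, 6, 6)` of `𝓕_m^∨`, `𝓕_m` (the local-to-global E₂ bound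
`E₂^{p,q} = H^p(D, Λ^q N_D)`: `Hom = ℂ`, `Ext¹ ↪ H¹(𝒪_D) ⊕ H⁰(N_D)` = twists ⊕ translations, `Ext² ↪ H²(𝒪_D) ⊕ H¹(K_D)`, dimensions `(1, 3+3, 3+3)`;
THETA-SECANT-p1 §2 (S3), BY VALUE) and Künneth (§8.4, BY VALUE); the squeeze «48 ≤ rank σ ≤ dim Ext² ≤ 48» then forces the profile
`(1, 6, 6, 1)` ON PAPER (census D-2: «Ext• profile forced (1,6,6,1)-type, dim Ext² = 48 exactly»). The only numbers left as hypotheses are the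
factor cells. BY NAME: `weilFamilyReach_hyperbolic`, `PerfectComplexRankTransfer C`. Conclusion: split `ℚ(√-d)` sixfolds AND all `ℚ(√-d)`
fourfolds — rows of record `d ∈ {3, 15, 35, 63, 99}` (`m = 2, 4, 6, 8, 10`). [cite: Markman2025SecantWeil, Thm. 1.5.1, Cor. 1.6.1 and §8.4 (preprint)]
[cite: BuchweitzFlenner2008HH, Prop. 6.4.4] [cite: Mukai1981, Thm. 2.2] [cite: Orlov2002DerivedAbelian, Assertion 2.8]
[cite: Deligne1982HodgeCycles, proof of Thm. 4.8] -/
theorem weilSixfoldsSplit_and_fourfoldsAll_of_reach_of_perfectComplexRankTransfer_of_thetaSecant_factorWindow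
    (hF' : weilFamilyReach_hyperbolic) (hT : PerfectComplexRankTransfer C) {d : ℕ} (hd : 0 < d)
    (P : AbelianVariety ℂ) (ψ₀ : P ⟶ P) (e : ProjectiveEmbedding P.X) (a : complexBetti (projectiveSpace e.n ℂ) 2)
    (hP : P.dim = 2 * 3) (hψ : ψ₀ ≫ ψ₀ = -(d • 𝟙 P)) (ha : IsRationalClass a) (ha0 : a ≠ 0)
    (hhyp : IsHyperbolicWeilType P ψ₀ 3 (symmetrisedClass d P ψ₀ e a))
    (w : complexBetti P.X (2 * 3)) (hwW : w ∈ weilClassesOf P ψ₀ 3 d) (hwr : IsRationalClass w) (hw0 : w ≠ 0)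
    (I : Finset ℕ) (hI : ∀ p : ℕ, 1 ≤ p → p ≤ 2 * 3 → p ∈ I) (E : CochainComplex P.X.left.Modules ℤ) (hE : IsBoundedVBComplex E)
    (q : ℚ) (cq : ℕ → ℚ)
    (hch3 : chPerfect C P.X E hE.isFiniteLocallyFree 3 = ((q : ℚ) : ℂ) • cupPowTwo (symmetrisedClass d P ψ₀ e a) 3 + w)
    (hchp : ∀ p ∈ I, p ≠ 3 →
      chPerfect C P.X E hE.isFiniteLocallyFree p = ((cq p : ℚ) : ℂ) • cupPowTwo (symmetrisedClass d P ψ₀ e a) p)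
    -- the object side: the source box, its transport, and its two FACTORS in the window (BY VALUE)
    (G : CochainComplex Y₀.left.Modules ℤ) (hext : ∀ m : ℤ, m ≤ 2 → extRank P.X E m = extRank Y₀ G m)
    (hneg : ∀ m : ℤ, m < 0 → extRank Y₀ G m = 0) (h0 : extRank Y₀ G 0 = 1)
    (F₁ : CochainComplex Y₁.left.Modules ℤ) (F₂ : CochainComplex Y₂.left.Modules ℤ)
    (hK : extRank Y₀ G (2 : ℕ) = ∑ ij ∈ antidiagonal (2 : ℕ), extRank Y₁ F₁ ij.1 * extRank Y₂ F₂ ij.2)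
    (hF₁ : ∀ i : ℕ, i ≤ 2 → extRank Y₁ F₁ i ≤ transversePairRank 3 i)
    (hF₂ : ∀ j : ℕ, j ≤ 2 → extRank Y₂ F₂ j ≤ transversePairRank 3 j)
    -- the twisted theta box on the source frame (BY VALUE)
    (hAsrc : IsSmoothProjective Asrc.dim Asrc.X) (κs : ∀ p : ℕ, complexBetti Asrc.X (2 * p))
    (hV : IsCompl V₁ V₂) (b₁ : Module.Basis (Fin 3 ⊕ Fin 3) ℂ V₁) (b₂ : Module.Basis (Fin 3 ⊕ Fin 3) ℂ V₂)
    (hL : hodgeZeroOne hAsrc = L₁ ⊔ L₂) (hL₁ : L₁ ≤ V₁) (hL₂ : L₂ ≤ V₂)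
    (hbL₁ : Submodule.span ℂ (Set.range (⇑b₁ ∘ Sum.inr)) = L₁.comap V₁.subtype)
    (hbL₂ : Submodule.span ℂ (Set.range (⇑b₂ ∘ Sum.inr)) = L₂.comap V₂.subtype) {N₁ N₂ : ℕ}
    (hN₁ : ExteriorLefschetz.twoVector b₁ ^ N₁ = 0) (hN₂ : ExteriorLefschetz.twoVector b₂ ^ N₂ = 0)
    {a₁ a₁' a₂ a₂' : ℂ} (ha₁ : a₁ ≠ 0) (ha₁' : a₁' ≠ 0) (ha₂ : a₂ ≠ 0) (ha₂' : a₂' ≠ 0)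
    {cs : ExteriorAlgebra ℂ (complexBetti Asrc.X 1)}
    (hcs : cs ∈ Submodule.span ℂ {z : ExteriorAlgebra ℂ (complexBetti Asrc.X 1) |
      ∃ v : complexBetti Asrc.X 1, ∃ q ∈ hodgeZeroOneSet Asrc, z = ι ℂ v * ι ℂ q}) {Ns : ℕ} (hNs : cs ^ Ns = 0)
    (hbox : totalExteriorClass Asrc κs =
      ExteriorAlgebra.map V₁.subtype (algebraMap ℂ _ a₁ +
          a₁' • ∑ k ∈ Finset.range N₁, ((k.factorial : ℂ)⁻¹) • ExteriorLefschetz.twoVector b₁ ^ k) *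
        ExteriorAlgebra.map V₂.subtype (algebraMap ℂ _ a₂ +
          a₂' • ∑ k ∈ Finset.range N₂, ((k.factorial : ℂ)⁻¹) • ExteriorLefschetz.twoVector b₂ ^ k) *
        ∑ k ∈ Finset.range Ns, ((k.factorial : ℂ)⁻¹) • cs ^ k)
    -- the transport and the untwisted target class (BY VALUE)
    (κ₀ : ∀ p : ℕ, complexBetti P.X (2 * p))
    (g : complexBetti Asrc.X 1 ≃ₗ[ℂ] W₁ × W₂) (g' : complexBetti P.X 1 ≃ₗ[ℂ] W₁ × Module.Dual ℂ W₂)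
    (hM : ⇑g '' hodgeZeroOneSet Asrc = (M₁.prod M₂ : Set (W₁ × W₂)))
    (hM' : ⇑g' '' hodgeZeroOneSet P = (M₁.prod M₂.dualAnnihilator : Set (W₁ × Module.Dual ℂ W₂)))
    (hF : ExteriorAlgebra.map g'.toLinearMap (totalExteriorClass P κ₀) =
      ContractionSpan.partialFourier β₂ (ExteriorAlgebra.map g.toLinearMap (totalExteriorClass Asrc κs)))
    -- the target twist (BY VALUE)
    {ct : ExteriorAlgebra ℂ (complexBetti P.X 1)}
    (hct : ct ∈ Submodule.span ℂ {z : ExteriorAlgebra ℂ (complexBetti P.X 1) |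
      ∃ v : complexBetti P.X 1, ∃ q ∈ hodgeZeroOneSet P, z = ι ℂ v * ι ℂ q}) {Nt : ℕ} (hNt : ct ^ Nt = 0)
    (htw : totalExteriorClass P (fun p ↦ chPerfect C P.X E hE.isFiniteLocallyFree p) =
      totalExteriorClass P κ₀ * ∑ k ∈ Finset.range Nt, ((k.factorial : ℂ)⁻¹) • ct ^ k) :
    Stubs.WeilAlgebraicSplitHyperplane 3 d ∧ WeilAlgebraicAll 2 d :=
  weilSixfoldsSplit_and_fourfoldsAll_of_reach_of_perfectComplexRankTransfer_of_thetaSecant β₂ M₁ M₂ hF' hT hd P ψ₀ e a hP hψ ha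
    ha0 hhyp w hwW hwr hw0 I hI E hE q cq hch3 hchp G hext hneg h0 (extRank_box_three_le_of_factorWindow G F₁ F₂ hK hF₁ hF₂) hAsrc
    κs hV b₁ b₂ hL hL₁ hL₂ hbL₁ hbL₂ hN₁ hN₂ ha₁ ha₁' ha₂ ha₂' hcs hNs hbox κ₀ g g' hM hM' hF hct hNt htw

/-! ## §4 Level `N`: two factors in the window feed seat p11's ladder (import, not restate) -/

/-- **LEVEL `N ≥ 1`: two FACTORS IN THE WINDOW + Künneth + the class side `r = R₂(N)` ⟹ the LADDER** (seat p11's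
`ladder_of_reach_of_perfectComplexRankTransfer_of_complex`, its object-side binder `h2` PRODUCED here): BY NAME `weilFamilyReach_hyperbolic`,
`PerfectComplexRankTransfer C`; BY VALUE a split `ℚ(√-d)`-Weil `2N`-fold anchor `(P, ψ₀)`, `w ≠ 0`, `I ⊇ {1..2N}`, ONE bounded complex of
vector bundles `E` with `ch_N(E) = q·h_Kᴺ + w`, `ch_p(E) = c_p·h_Kᵖ` off `N`, the class-side number `hr : r(P, ch E) = boxRank N 2 = R₂(N)`
(`18, 48, 88, 140, …`; kernel-evaluable from the class SHAPE: seats p4/p10 point-pair box, seat p8 theta box — §5), its source `G` with `hext`,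
`Ext^{<0}(G,G) = 0`, `Hom(G,G) = ℂ`, and two factors `F₁`, `F₂` with profiles IN THE WINDOW `≤ (r₀, r₁, r₂)(N)` (`= (1, 2N, N(N−1))` for
`N ≥ 3`, seat p10's `markmanWindow_eq`; [Markman2025SecantWeil] Lemma 8.3.4 as read by the cell) and the Künneth identity in degree `2`. Then
`dim Ext²(E,E) ≤ R₂(N) = r(P, ch E)` (the admissibility clause; WITH EQUALITY for EXTREMAL factors, §1 — STRUCTURE (S2)) and:
`Stubs.WeilAlgebraicSplitHyperplane N d` (the split `ℚ(√-d)`-Weil `2N`-folds) `∧ ∀ n, 2 ≤ n < N → WeilAlgebraicAll n d` (ALL `ℚ(√-d)`-Weil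
`2n`-folds below, every discriminant; STRUCTURE §3.0). `N = 3`: §3; `N = 2`: the g = 4 anchor (`(1,4,1)`, `18`); `N = 5, 6`: the rungs
STRUCTURE (S4) names (no such factor of record there: family S «8/8 NOT semiregular», the `n = 6` rung sieved). Nothing asserted.
[cite: Markman2025SecantWeil, Thm. 1.5.1, Cor. 1.6.1 and §8.4 (preprint)] [cite: BuchweitzFlenner2008HH, Prop. 6.4.4]
[cite: Schoen1998HodgeWeilAddendum, §10] [cite: Deligne1982HodgeCycles, proof of Thm. 4.8] -/
theorem ladder_of_reach_of_perfectComplexRankTransfer_of_factorWindow (hF : weilFamilyReach_hyperbolic)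
    (hT : PerfectComplexRankTransfer C) {N d : ℕ} (hN : 1 ≤ N) (hd : 0 < d)
    (P : AbelianVariety ℂ) (ψ₀ : P ⟶ P) (e : ProjectiveEmbedding P.X) (a : complexBetti (projectiveSpace e.n ℂ) 2)
    (hP : P.dim = 2 * N) (hψ : ψ₀ ≫ ψ₀ = -(d • 𝟙 P)) (ha : IsRationalClass a) (ha0 : a ≠ 0)
    (hhyp : IsHyperbolicWeilType P ψ₀ N (symmetrisedClass d P ψ₀ e a))
    (w : complexBetti P.X (2 * N)) (hwW : w ∈ weilClassesOf P ψ₀ N d) (hwr : IsRationalClass w) (hw0 : w ≠ 0)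
    (I : Finset ℕ) (hI : ∀ p : ℕ, 1 ≤ p → p ≤ 2 * N → p ∈ I) (E : CochainComplex P.X.left.Modules ℤ)
    (hE : IsBoundedVBComplex E) (q : ℚ) (c : ℕ → ℚ)
    (hchN : chPerfect C P.X E hE.isFiniteLocallyFree N = ((q : ℚ) : ℂ) • cupPowTwo (symmetrisedClass d P ψ₀ e a) N + w)
    (hchp : ∀ p ∈ I, p ≠ N →
      chPerfect C P.X E hE.isFiniteLocallyFree p = ((c p : ℚ) : ℂ) • cupPowTwo (symmetrisedClass d P ψ₀ e a) p)
    -- class side BY VALUE: `r(P, ch E) = R₂(N)`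
    (hr : contractionRank P (fun p ↦ chPerfect C P.X E hE.isFiniteLocallyFree p) = ((boxRank N 2 : ℕ) : Cardinal))
    -- object side: source box, transport, two FACTORS in the window, Künneth (BY VALUE)
    (G : CochainComplex Y₀.left.Modules ℤ) (hext : ∀ m : ℤ, m ≤ 2 → extRank P.X E m = extRank Y₀ G m)
    (hneg : ∀ m : ℤ, m < 0 → extRank Y₀ G m = 0) (h0 : extRank Y₀ G 0 = 1)
    (F₁ : CochainComplex Y₁.left.Modules ℤ) (F₂ : CochainComplex Y₂.left.Modules ℤ)
    (hK : extRank Y₀ G (2 : ℕ) = ∑ ij ∈ antidiagonal (2 : ℕ), extRank Y₁ F₁ ij.1 * extRank Y₂ F₂ ij.2)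
    (hF₁ : ∀ i : ℕ, i ≤ 2 → extRank Y₁ F₁ i ≤ transversePairRank N i)
    (hF₂ : ∀ j : ℕ, j ≤ 2 → extRank Y₂ F₂ j ≤ transversePairRank N j) :
    Stubs.WeilAlgebraicSplitHyperplane N d ∧ ∀ n : ℕ, 2 ≤ n → n < N → WeilAlgebraicAll n d := by
  refine ladder_of_reach_of_perfectComplexRankTransfer_of_complex hF hT hN hd P ψ₀ e a hP hψ ha ha0 hhyp w hwW hwr hw0 I hI E hE
    (fun k hk ↦ (hext k (by omega)).trans (hneg k hk)) ((hext 0 (by norm_num)).trans h0) ?_ q c hchN hchp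
  rw [hext 2 le_rfl, hr, Cardinal.lift_natCast]
  exact extRank_le_boxRank_of_kunneth_of_window G F₁ F₂ (n := N) (k := 2) hK hF₁ hF₂

/-! ## §5 The theta-secant SHAPE at every level `n ≥ 3`: both sides of «`R₂(n) = R₂(n)`» produced in the kernel -/

/-- **THE THETA-SECANT MECHANISM IS UNIFORM IN `n ≥ 3`: class side `r(P, ch E) = 6n² − 2n` from the twisted-theta-box SHAPE (seat p8's
`contractionRank_eq_of_partialFourier_thetaBox`, every `n ≥ 3`), object side `dim Ext²(G,G) ≤ n(n−1) + 4n² + n(n−1) = 6n² − 2n` from two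
FACTOR WINDOWS `≤ (1, 2n, n(n−1))` + Künneth (§1), and `6n² − 2n = R₂(n) = boxRank n 2` (seat p10's `boxRank_two`) — so the rank door's
clause holds at every level (with equality for extremal factors), and §4 gives the LADDER.** BY NAME: `weilFamilyReach_hyperbolic`,
`PerfectComplexRankTransfer C`. BY VALUE: a split `ℚ(√-d)`-Weil `2n`-fold anchor with class data, ONE bounded complex of vector bundles `E`
whose total Chern class is the partial-Fourier transport of a twisted theta box on a source abelian `2n`-fold `Asrc` (frame binders as in
seat p8's `…_of_thetaSecant`, with `Fin n ⊕ Fin n` Darboux-type bases), twisted on the target; its source `G` (`hext`, `Ext^{<0} = 0`,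
`Hom = ℂ`) and two factors in the window `(r₀, r₁, r₂)(n)`; the Künneth identity. NO numeral hypothesis remains: the only by-value NUMBERS are
the factor cells `≤ (1, 2n, n(n−1))` (for a line bundle on a smooth theta divisor of a p.p. abelian `n`-fold the E₂ bound `H^p(D, Λ^q N_D)`
gives `(1, n + n, C(n,2) + C(n,2))` by Lefschetz + `hⁱ(𝒪_X(Θ)) = 0`, `i > 0` — THETA-SECANT-p1 §2 (S3) at `n = 3`; at other `n` an EXPECTATION of the cell (STRUCTURE (S4):
«the THETA family … extremal by th-7's squeeze»), not a record). Conclusion: `Stubs.WeilAlgebraicSplitHyperplane n d ∧ ∀ k, 2 ≤ k < n →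
WeilAlgebraicAll k d`.
At `n = 3` this is §3's second form. Whether such objects EXIST at a given level with CLASS-ALIVE `w ≠ 0` is exactly STRUCTURE (S4) (open
at `n = 5`, `n ≡ 2 (mod 4)`; excluded at `n ≡ 0 (mod 4)` by (S3); the theta family is CLASS-DEAD at `n = 6` on p.p.a.v., p1 N6-SIEVE) —
nothing here asserts it. [cite: Markman2025SecantWeil, Thm. 1.5.1, Cor. 1.6.1 and §8.4 (preprint)] [cite: BuchweitzFlenner2008HH, Prop. 6.4.4]
[cite: Mukai1981, Thm. 2.2] [cite: Orlov2002DerivedAbelian, Assertion 2.8] [cite: MumfordAV1970, §1 (4) and §4 (iii)]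
[cite: Deligne1982HodgeCycles, proof of Thm. 4.8] -/
theorem ladder_of_reach_of_perfectComplexRankTransfer_of_thetaBox_factorWindow (hF' : weilFamilyReach_hyperbolic)
    (hT : PerfectComplexRankTransfer C) {n d : ℕ} (hn : 3 ≤ n) (hd : 0 < d)
    (P : AbelianVariety ℂ) (ψ₀ : P ⟶ P) (e : ProjectiveEmbedding P.X) (a : complexBetti (projectiveSpace e.n ℂ) 2)
    (hP : P.dim = 2 * n) (hψ : ψ₀ ≫ ψ₀ = -(d • 𝟙 P)) (ha : IsRationalClass a) (ha0 : a ≠ 0)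
    (hhyp : IsHyperbolicWeilType P ψ₀ n (symmetrisedClass d P ψ₀ e a))
    (w : complexBetti P.X (2 * n)) (hwW : w ∈ weilClassesOf P ψ₀ n d) (hwr : IsRationalClass w) (hw0 : w ≠ 0)
    (I : Finset ℕ) (hI : ∀ p : ℕ, 1 ≤ p → p ≤ 2 * n → p ∈ I) (E : CochainComplex P.X.left.Modules ℤ)
    (hE : IsBoundedVBComplex E) (q : ℚ) (cq : ℕ → ℚ)
    (hchn : chPerfect C P.X E hE.isFiniteLocallyFree n = ((q : ℚ) : ℂ) • cupPowTwo (symmetrisedClass d P ψ₀ e a) n + w)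
    (hchp : ∀ p ∈ I, p ≠ n →
      chPerfect C P.X E hE.isFiniteLocallyFree p = ((cq p : ℚ) : ℂ) • cupPowTwo (symmetrisedClass d P ψ₀ e a) p)
    -- object side: source box, transport, two FACTORS in the window `(1, 2n, n(n−1))`, Künneth (BY VALUE)
    (G : CochainComplex Y₀.left.Modules ℤ) (hext : ∀ m : ℤ, m ≤ 2 → extRank P.X E m = extRank Y₀ G m)
    (hneg : ∀ m : ℤ, m < 0 → extRank Y₀ G m = 0) (h0 : extRank Y₀ G 0 = 1)
    (F₁ : CochainComplex Y₁.left.Modules ℤ) (F₂ : CochainComplex Y₂.left.Modules ℤ)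
    (hK : extRank Y₀ G (2 : ℕ) = ∑ ij ∈ antidiagonal (2 : ℕ), extRank Y₁ F₁ ij.1 * extRank Y₂ F₂ ij.2)
    (hF₁ : ∀ i : ℕ, i ≤ 2 → extRank Y₁ F₁ i ≤ transversePairRank n i)
    (hF₂ : ∀ j : ℕ, j ≤ 2 → extRank Y₂ F₂ j ≤ transversePairRank n j)
    -- class side: the twisted theta box on the source frame, its partial-Fourier transport, the target twist (BY VALUE)
    (hAsrc : IsSmoothProjective Asrc.dim Asrc.X) (κs : ∀ p : ℕ, complexBetti Asrc.X (2 * p))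
    (hV : IsCompl V₁ V₂) (b₁ : Module.Basis (Fin n ⊕ Fin n) ℂ V₁) (b₂ : Module.Basis (Fin n ⊕ Fin n) ℂ V₂)
    (hL : hodgeZeroOne hAsrc = L₁ ⊔ L₂) (hL₁ : L₁ ≤ V₁) (hL₂ : L₂ ≤ V₂)
    (hbL₁ : Submodule.span ℂ (Set.range (⇑b₁ ∘ Sum.inr)) = L₁.comap V₁.subtype)
    (hbL₂ : Submodule.span ℂ (Set.range (⇑b₂ ∘ Sum.inr)) = L₂.comap V₂.subtype) {N₁ N₂ : ℕ}
    (hN₁ : ExteriorLefschetz.twoVector b₁ ^ N₁ = 0) (hN₂ : ExteriorLefschetz.twoVector b₂ ^ N₂ = 0)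
    {a₁ a₁' a₂ a₂' : ℂ} (ha₁ : a₁ ≠ 0) (ha₁' : a₁' ≠ 0) (ha₂ : a₂ ≠ 0) (ha₂' : a₂' ≠ 0)
    {cs : ExteriorAlgebra ℂ (complexBetti Asrc.X 1)}
    (hcs : cs ∈ Submodule.span ℂ {z : ExteriorAlgebra ℂ (complexBetti Asrc.X 1) |
      ∃ v : complexBetti Asrc.X 1, ∃ q ∈ hodgeZeroOneSet Asrc, z = ι ℂ v * ι ℂ q}) {Ns : ℕ} (hNs : cs ^ Ns = 0)
    (hbox : totalExteriorClass Asrc κs =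
      ExteriorAlgebra.map V₁.subtype (algebraMap ℂ _ a₁ +
          a₁' • ∑ k ∈ Finset.range N₁, ((k.factorial : ℂ)⁻¹) • ExteriorLefschetz.twoVector b₁ ^ k) *
        ExteriorAlgebra.map V₂.subtype (algebraMap ℂ _ a₂ +
          a₂' • ∑ k ∈ Finset.range N₂, ((k.factorial : ℂ)⁻¹) • ExteriorLefschetz.twoVector b₂ ^ k) *
        ∑ k ∈ Finset.range Ns, ((k.factorial : ℂ)⁻¹) • cs ^ k)
    (κ₀ : ∀ p : ℕ, complexBetti P.X (2 * p))
    (g : complexBetti Asrc.X 1 ≃ₗ[ℂ] W₁ × W₂) (g' : complexBetti P.X 1 ≃ₗ[ℂ] W₁ × Module.Dual ℂ W₂)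
    (hM : ⇑g '' hodgeZeroOneSet Asrc = (M₁.prod M₂ : Set (W₁ × W₂)))
    (hM' : ⇑g' '' hodgeZeroOneSet P = (M₁.prod M₂.dualAnnihilator : Set (W₁ × Module.Dual ℂ W₂)))
    (hF : ExteriorAlgebra.map g'.toLinearMap (totalExteriorClass P κ₀) =
      ContractionSpan.partialFourier β₂ (ExteriorAlgebra.map g.toLinearMap (totalExteriorClass Asrc κs)))
    {ct : ExteriorAlgebra ℂ (complexBetti P.X 1)}
    (hct : ct ∈ Submodule.span ℂ {z : ExteriorAlgebra ℂ (complexBetti P.X 1) |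
      ∃ v : complexBetti P.X 1, ∃ q ∈ hodgeZeroOneSet P, z = ι ℂ v * ι ℂ q}) {Nt : ℕ} (hNt : ct ^ Nt = 0)
    (htw : totalExteriorClass P (fun p ↦ chPerfect C P.X E hE.isFiniteLocallyFree p) =
      totalExteriorClass P κ₀ * ∑ k ∈ Finset.range Nt, ((k.factorial : ℂ)⁻¹) • ct ^ k) :
    Stubs.WeilAlgebraicSplitHyperplane n d ∧ ∀ k : ℕ, 2 ≤ k → k < n → WeilAlgebraicAll k d := by
  -- class side in the kernel: `r(P, ch E) = 6n² − 2n = boxRank n 2`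
  have hr : contractionRank P (fun p ↦ chPerfect C P.X E hE.isFiniteLocallyFree p) = ((boxRank n 2 : ℕ) : Cardinal) := by
    have h := contractionRank_eq_of_partialFourier_thetaBox β₂ M₁ M₂ hAsrc κs κ₀ _ hn hV b₁ b₂ hL hL₁ hL₂ hbL₁ hbL₂ hN₁ hN₂
      ha₁ ha₁' ha₂ ha₂' hcs hNs hbox g g' hM hM' hF hct hNt htw
    have hb := FormulaN.Uniform.boxRank_two hn
    rw [h, show 6 * n ^ 2 - 2 * n = boxRank n 2 by omega]
  exact ladder_of_reach_of_perfectComplexRankTransfer_of_factorWindow hF' hT (by omega) hd P ψ₀ e a hP hψ ha ha0 hhyp w hwW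
    hwr hw0 I hI E hE q cq hchn hchp hr G hext hneg h0 F₁ F₂ hK hF₁ hF₂

end Instances

/-! ## Audit: nothing is decided here
KERNEL: §1 (factor windows + Künneth numbers ⟹ `rank Ext^k(G,G) ≤ R_k(n)`, `=` for extremal factors), §2 (the numerals `48` / `18`), §3 (the g = 6
method instance composed: seat p8's certificate / theta-secant forms with the object side from factor cells), §4 (level `N` via seat p11's
ladder), §5 (theta shape at every `n ≥ 3`, class side `6n² − 2n = boxRank n 2` in the kernel). BY VALUE: anchors, classes, the object `E` with
`G`, `hext`, `hneg`, `h0`, the Künneth identity `hK`, the FACTOR WINDOWS `hF₁`, `hF₂` (the census's factor cells), §3-first-form's / §4's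
class-side number `hr`, §3-second-form's / §5's frame binders. BY NAME: `weilFamilyReach_hyperbolic` (refereed),
`PerfectComplexRankTransfer C` (assumption). Not here: any non-split sixfold (the verdict's deciding rows: «NO-in-families-tried»,
candidates 0), HC_CM, CM density, MT finiteness, `σ ∘ ob = ⌟ch` as a kernel fact, any `Ext` group of any explicit sheaf. -/

end Summit.Ventures.HSemireg

end
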